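import Literature.Geometry.Lorentzian.CoordMetricVariation
import Mathlib.Analysis.Calculus.MeanValue
import HarnessLib

/-!
# Iterated partial derivatives along a basis, and bounded families of them
(topic `Geometry/Lorentzian`, coordinate calculus)

Bookkeeping for the sentence "within a local coordinate chart, all space-time derivatives of
`g_{ij}` are bounded" (Topping 2006, proof of Thm. 5.3.1, p. 47) at the level of scalar
component functions on the model space `E` with a basis `b`:

* `pd b i φ` — the partial derivative `∂_i φ = dφ(b_i)`; `pdIter b L φ` — the iterated partial
  derivative `∂_{i_k} ⋯ ∂_{i_1} φ` along a list of basis directions; smoothness, congruence on open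
  sets, linearity and the Leibniz rule;
* `PDBddOn b S K n Φ` — for a time-dependent scalar field `Φ : ℝ → E → ℝ`, all iterated partial
  derivatives of order `≤ n` of the slices `Φ t`, `t ∈ S`, are bounded on `K`; closed under
  sums, products and constants (anisotropic Leibniz bookkeeping, `PDBddOn.mul`);
* time derivatives: `derivWithin_pdIter_comm` (`∂_t ∂^L = ∂^L ∂_t` for jointly smooth families,
  symmetry of mixed partials) and `PDBddOn`-free **time integration**
  `abs_pdIter_le_of_deriv` (a bound for `∂_t ∂^L Φ` on `[t₁, T) × K` and for `∂^L Φ(t₁)` on `K`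
  bounds `∂^L Φ` on `[t₁, T) × K`, mean value inequality).

## References

* P. Topping, *Lectures on the Ricci flow*, LMS Lecture Note Series 325, CUP 2006, proof of
  Thm. 5.3.1, pp. 47–48. [Topping2006]
* J. Dieudonné, *Foundations of Modern Analysis* (1960), (8.12) (partial derivatives).
-/

noncomputable section

open Set Filter Module Function
open scoped Topology ContDiff

namespace Literature.Geometry.Lorentzian

namespace MetricCoord

variable {E : Type*} [NormedAddCommGroup E] [NormedSpace ℝ E] {ι : Type*} (b : Basis ι ℝ E)

/-! ### Partial derivatives along basis vectors -/

section PD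

/-- The partial derivative of a scalar function along the basis vector `b i`:
`∂_i φ (y) = dφ_y(b_i)`. [folklore] -/
def pd (i : ι) (φ : E → ℝ) : E → ℝ := fun y ↦ fderiv ℝ φ y (b i)

/-- Iterated partial derivatives along a list of basis directions:
`pdIter [i₁, …, i_k] φ = ∂_{i_k} ⋯ ∂_{i_1} φ` (the head is applied first). [folklore] -/
def pdIter : List ι → (E → ℝ) → E → ℝ
  | [] => fun φ ↦ φ
  | i :: L => fun φ ↦ pdIter L (pd b i φ)

variable {b} {V : Set E} {φ ψ : E → ℝ} {y : E}

/-- Unfolding lemma for `pd`. [folklore] -/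
theorem pd_apply (i : ι) (φ : E → ℝ) (y : E) : pd b i φ y = fderiv ℝ φ y (b i) := rfl

/-- `pdIter [] φ = φ`. [folklore] -/
@[simp] theorem pdIter_nil (φ : E → ℝ) : pdIter b [] φ = φ := rfl

/-- `pdIter (i :: L) φ = pdIter L (∂_i φ)`. [folklore] -/
@[simp] theorem pdIter_cons (i : ι) (L : List ι) (φ : E → ℝ) :
    pdIter b (i :: L) φ = pdIter b L (pd b i φ) := rfl

/-- `∂_i` of a `C^∞` function on an open set is `C^∞` there. [folklore] -/
theorem _root_.ContDiffOn.pd (hV : IsOpen V) (hφ : ContDiffOn ℝ ∞ φ V) (i : ι) :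
    ContDiffOn ℝ ∞ (pd b i φ) V :=
  (hφ.fderiv_of_isOpen hV le_rfl).clm_apply contDiffOn_const

/-- Iterated partial derivatives of a `C^∞` function on an open set are `C^∞`. [folklore] -/
theorem contDiffOn_pdIter (hV : IsOpen V) :
    ∀ (L : List ι) {φ : E → ℝ}, ContDiffOn ℝ ∞ φ V → ContDiffOn ℝ ∞ (pdIter b L φ) V
  | [], _, hφ => hφ
  | i :: L, φ, hφ => contDiffOn_pdIter hV L (φ := pd b i φ) (hφ.pd hV i)

/-- Iterated partial derivatives of a `C^∞` function on an open set are `C^∞` (dot form).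
[folklore] -/
theorem _root_.ContDiffOn.pdIter (hV : IsOpen V) (hφ : ContDiffOn ℝ ∞ φ V) (L : List ι) :
    ContDiffOn ℝ ∞ (pdIter b L φ) V :=
  contDiffOn_pdIter hV L hφ

/-- `∂_i` only depends on the function on an open set. [folklore] -/
theorem pd_congr (hV : IsOpen V) (h : EqOn φ ψ V) (i : ι) : EqOn (pd b i φ) (pd b i ψ) V := by
  intro y hy
  have hev : φ =ᶠ[𝓝 y] ψ := Filter.eventually_of_mem (hV.mem_nhds hy) h
  simp only [pd_apply, hev.fderiv_eq]

/-- `pdIter L` only depends on the function on an open set. [folklore] -/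
theorem pdIter_congr (hV : IsOpen V) : ∀ (L : List ι) {φ ψ : E → ℝ}, EqOn φ ψ V →
    EqOn (pdIter b L φ) (pdIter b L ψ) V
  | [], _, _, h => h
  | i :: L, _, _, h => pdIter_congr hV L (pd_congr hV h i)

/-- `∂_i (φ + ψ) = ∂_i φ + ∂_i ψ` at points of differentiability. [folklore] -/
theorem pd_add (hφ : DifferentiableAt ℝ φ y) (hψ : DifferentiableAt ℝ ψ y) (i : ι) :
    pd b i (fun z ↦ φ z + ψ z) y = pd b i φ y + pd b i ψ y := by
  simp only [pd_apply, fderiv_fun_add hφ hψ, _root_.add_apply]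

/-- `∂_i (c φ) = c ∂_i φ` at points of differentiability. [folklore] -/
theorem pd_const_mul (hφ : DifferentiableAt ℝ φ y) (c : ℝ) (i : ι) :
    pd b i (fun z ↦ c * φ z) y = c * pd b i φ y := by
  simp only [pd_apply, fderiv_const_mul hφ c, _root_.smul_apply, smul_eq_mul]

/-- **Leibniz rule** `∂_i (φ ψ) = (∂_i φ) ψ + φ (∂_i ψ)` at points of differentiability. [folklore] -/
theorem pd_mul (hφ : DifferentiableAt ℝ φ y) (hψ : DifferentiableAt ℝ ψ y) (i : ι) :
    pd b i (fun z ↦ φ z * ψ z) y = pd b i φ y * ψ y + φ y * pd b i ψ y := by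
  simp only [pd_apply, fderiv_fun_mul hφ hψ, _root_.add_apply, _root_.smul_apply, smul_eq_mul]
  ring

/-- `∂_i` of a constant vanishes. [folklore] -/
theorem pd_const (c : ℝ) (i : ι) : pd b i (fun _ : E ↦ c) = 0 := by
  funext y; rw [pd_apply, Pi.zero_apply]; simp

/-- `pdIter L 0 = 0` — stated for `pd`-free lists via the zero function. [folklore] -/
theorem pdIter_zero_fun' (h0 : ∀ i : ι, pd b i (0 : E → ℝ) = 0) : ∀ L : List ι, pdIter b L (0 : E → ℝ) = 0
  | [] => rfl
  | i :: L => by rw [pdIter_cons, h0 i, pdIter_zero_fun' h0 L]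

/-- `pdIter L 0 = 0`. [folklore] -/
theorem pdIter_zero_fun (L : List ι) : pdIter b L (0 : E → ℝ) = 0 :=
  pdIter_zero_fun' (fun i ↦ pd_const (b := b) 0 i) L

/-- `pdIter L (φ + ψ) = pdIter L φ + pdIter L ψ` on an open set where both are `C^∞`. [folklore] -/
theorem pdIter_add (hV : IsOpen V) : ∀ (L : List ι) {φ ψ : E → ℝ}, ContDiffOn ℝ ∞ φ V →
    ContDiffOn ℝ ∞ ψ V → EqOn (pdIter b L (fun z ↦ φ z + ψ z)) (fun z ↦ pdIter b L φ z + pdIter b L ψ z) V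
  | [], _, _, _, _ => fun _ _ ↦ rfl
  | i :: L, φ, ψ, hφ, hψ => by
    intro y hy
    have h1 : EqOn (pd b i (fun z ↦ φ z + ψ z)) (fun z ↦ pd b i φ z + pd b i ψ z) V := fun z hz ↦
      pd_add ((hφ.contDiffAt (hV.mem_nhds hz)).differentiableAt (by simp))
        ((hψ.contDiffAt (hV.mem_nhds hz)).differentiableAt (by simp)) i
    rw [pdIter_cons, pdIter_congr hV L h1 hy]
    exact pdIter_add hV L (hφ.pd hV i) (hψ.pd hV i) hy

/-- `pdIter L (c φ) = c pdIter L φ` on an open set where `φ` is `C^∞`. [folklore] -/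
theorem pdIter_const_mul (hV : IsOpen V) (c : ℝ) : ∀ (L : List ι) {φ : E → ℝ}, ContDiffOn ℝ ∞ φ V →
    EqOn (pdIter b L (fun z ↦ c * φ z)) (fun z ↦ c * pdIter b L φ z) V
  | [], _, _ => fun _ _ ↦ rfl
  | i :: L, φ, hφ => by
    intro y hy
    have h1 : EqOn (pd b i (fun z ↦ c * φ z)) (fun z ↦ c * pd b i φ z) V := fun z hz ↦
      pd_const_mul ((hφ.contDiffAt (hV.mem_nhds hz)).differentiableAt (by simp)) c i
    rw [pdIter_cons, pdIter_congr hV L h1 hy]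
    exact pdIter_const_mul hV c L (hφ.pd hV i) hy

end PD

/-! ### Bounded iterated partial derivatives of a time-dependent scalar field -/

section Bdd

variable {b} {V K : Set E} {S : Set ℝ} {Φ Ψ : ℝ → E → ℝ} {n : ℕ}

variable (b) in
/-- **All iterated partial derivatives of order `≤ n` of the slices `Φ t`, `t ∈ S`, are bounded
on `K`** (Topping 2006, p. 47: `|D^α g_{ab}| ≤ C` for `|α| ≤ n`). [cite: Topping2006, §5.3, p. 47] -/
def PDBddOn (S : Set ℝ) (K : Set E) (n : ℕ) (Φ : ℝ → E → ℝ) : Prop :=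
  ∀ L : List ι, L.length ≤ n → ∃ C : ℝ, ∀ t ∈ S, ∀ y ∈ K, |pdIter b L (Φ t) y| ≤ C

/-- The slices are `C^∞` on the open set `V`. [folklore] -/
def SmoothSlicesOn (V : Set E) (S : Set ℝ) (Φ : ℝ → E → ℝ) : Prop :=
  ∀ t ∈ S, ContDiffOn ℝ ∞ (Φ t) V

/-- Monotonicity in the order. [folklore] -/
theorem PDBddOn.mono (h : PDBddOn b S K n Φ) {m : ℕ} (hmn : m ≤ n) : PDBddOn b S K m Φ :=
  fun L hL ↦ h L (hL.trans hmn)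

/-- Order `0`: a plain bound. [folklore] -/
theorem pdBddOn_zero_iff : PDBddOn b S K 0 Φ ↔ ∃ C : ℝ, ∀ t ∈ S, ∀ y ∈ K, |Φ t y| ≤ C := by
  constructor
  · intro h; simpa using h [] le_rfl
  · rintro ⟨C, hC⟩ L hL
    obtain rfl : L = [] := List.eq_nil_of_length_eq_zero (Nat.le_zero.mp hL)
    exact ⟨C, hC⟩

/-- The bound of order `0` contained in any `PDBddOn`. [folklore] -/
theorem PDBddOn.bound (h : PDBddOn b S K n Φ) : ∃ C : ℝ, ∀ t ∈ S, ∀ y ∈ K, |Φ t y| ≤ C :=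
  pdBddOn_zero_iff.mp (h.mono (Nat.zero_le _))

/-- `PDBddOn (n+1) Φ` gives `PDBddOn n (∂_i Φ)`. [folklore] -/
theorem PDBddOn.pd (h : PDBddOn b S K (n + 1) Φ) (i : ι) : PDBddOn b S K n (fun t ↦ pd b i (Φ t)) :=
  fun L hL ↦ h (i :: L) (by simpa using hL)

/-- Smooth slices have smooth partial derivatives. [folklore] -/
theorem SmoothSlicesOn.pd (hV : IsOpen V) (h : SmoothSlicesOn V S Φ) (i : ι) :
    SmoothSlicesOn V S (fun t ↦ pd b i (Φ t)) := fun t ht ↦ (h t ht).pd hV i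

/-- **Sums.** [folklore] -/
theorem PDBddOn.add (hV : IsOpen V) (hKV : K ⊆ V) (hΦs : SmoothSlicesOn V S Φ)
    (hΨs : SmoothSlicesOn V S Ψ) (hΦ : PDBddOn b S K n Φ) (hΨ : PDBddOn b S K n Ψ) :
    PDBddOn b S K n (fun t y ↦ Φ t y + Ψ t y) := by
  intro L hL
  obtain ⟨C₁, hC₁⟩ := hΦ L hL
  obtain ⟨C₂, hC₂⟩ := hΨ L hL
  refine ⟨C₁ + C₂, fun t ht y hy ↦ ?_⟩
  rw [pdIter_add hV L (hΦs t ht) (hΨs t ht) (hKV hy)]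
  exact (abs_add_le _ _).trans (add_le_add (hC₁ t ht y hy) (hC₂ t ht y hy))

/-- **Constant multiples.** [folklore] -/
theorem PDBddOn.const_mul (hV : IsOpen V) (hKV : K ⊆ V) (hΦs : SmoothSlicesOn V S Φ)
    (hΦ : PDBddOn b S K n Φ) (c : ℝ) : PDBddOn b S K n (fun t y ↦ c * Φ t y) := by
  intro L hL
  obtain ⟨C, hC⟩ := hΦ L hL
  refine ⟨|c| * C, fun t ht y hy ↦ ?_⟩
  rw [pdIter_const_mul hV c L (hΦs t ht) (hKV hy), abs_mul]
  exact mul_le_mul_of_nonneg_left (hC t ht y hy) (abs_nonneg c)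

/-- **Negation.** [folklore] -/
theorem PDBddOn.neg (hV : IsOpen V) (hKV : K ⊆ V) (hΦs : SmoothSlicesOn V S Φ)
    (hΦ : PDBddOn b S K n Φ) : PDBddOn b S K n (fun t y ↦ -Φ t y) := by
  have h := hΦ.const_mul hV hKV hΦs (-1)
  simpa using h

/-- **Differences.** [folklore] -/
theorem PDBddOn.sub (hV : IsOpen V) (hKV : K ⊆ V) (hΦs : SmoothSlicesOn V S Φ)
    (hΨs : SmoothSlicesOn V S Ψ) (hΦ : PDBddOn b S K n Φ) (hΨ : PDBddOn b S K n Ψ) :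
    PDBddOn b S K n (fun t y ↦ Φ t y - Ψ t y) := by
  have h := hΦ.add hV hKV hΦs (fun t ht ↦ (hΨs t ht).neg) (hΨ.neg hV hKV hΨs)
  simpa [sub_eq_add_neg] using h

/-- Smoothness of slices is preserved by sums. [folklore] -/
theorem SmoothSlicesOn.add (hΦs : SmoothSlicesOn V S Φ) (hΨs : SmoothSlicesOn V S Ψ) :
    SmoothSlicesOn V S (fun t y ↦ Φ t y + Ψ t y) := fun t ht ↦ (hΦs t ht).add (hΨs t ht)

/-- Smoothness of slices is preserved by products. [folklore] -/
theorem SmoothSlicesOn.mul (hΦs : SmoothSlicesOn V S Φ) (hΨs : SmoothSlicesOn V S Ψ) :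
    SmoothSlicesOn V S (fun t y ↦ Φ t y * Ψ t y) := fun t ht ↦ (hΦs t ht).mul (hΨs t ht)

/-- Smoothness of slices is preserved by constant multiples. [folklore] -/
theorem SmoothSlicesOn.const_mul (hΦs : SmoothSlicesOn V S Φ) (c : ℝ) :
    SmoothSlicesOn V S (fun t y ↦ c * Φ t y) := fun t ht ↦ contDiffOn_const.mul (hΦs t ht)

/-- `PDBddOn` only depends on the slices on an open set containing `K`. [folklore] -/
theorem PDBddOn.congr (hV : IsOpen V) (hKV : K ⊆ V) (hΨ : PDBddOn b S K n Ψ)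
    (h : ∀ t ∈ S, EqOn (Φ t) (Ψ t) V) : PDBddOn b S K n Φ := by
  intro L hL
  obtain ⟨C, hC⟩ := hΨ L hL
  exact ⟨C, fun t ht y hy ↦ by rw [pdIter_congr hV L (h t ht) (hKV hy)]; exact hC t ht y hy⟩

/-- `SmoothSlicesOn` only depends on the slices on `V`. [folklore] -/
theorem SmoothSlicesOn.congr (hΨ : SmoothSlicesOn V S Ψ) (h : ∀ t ∈ S, EqOn (Φ t) (Ψ t) V) :
    SmoothSlicesOn V S Φ := fun t ht ↦ (hΨ t ht).congr (h t ht)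

/-- A constant family. [folklore] -/
theorem pdBddOn_const (c : ℝ) : PDBddOn b S K n (fun (_ : ℝ) (_ : E) ↦ c) := by
  intro L _
  cases L with
  | nil => exact ⟨|c|, fun _ _ _ _ ↦ le_rfl⟩
  | cons i L =>
    refine ⟨0, fun t _ y _ ↦ ?_⟩
    rw [pdIter_cons, pd_const, pdIter_zero_fun]
    simp

/-- Constant families have smooth slices. [folklore] -/
theorem smoothSlicesOn_const (c : ℝ) : SmoothSlicesOn V S (fun (_ : ℝ) (_ : E) ↦ c) :=
  fun _ _ ↦ contDiffOn_const

/-- **Finite sums.** [folklore] -/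
theorem PDBddOn.sum (hV : IsOpen V) (hKV : K ⊆ V) {κ : Type*} (s : Finset κ) {F : κ → ℝ → E → ℝ}
    (hFs : ∀ k ∈ s, SmoothSlicesOn V S (F k)) (hF : ∀ k ∈ s, PDBddOn b S K n (F k)) :
    PDBddOn b S K n (fun t y ↦ ∑ k ∈ s, F k t y) := by
  classical
  induction s using Finset.induction_on with
  | empty =>
    intro L _
    refine ⟨0, fun t _ y _ ↦ ?_⟩
    simp only [Finset.sum_empty]
    rw [show (fun _ : E ↦ (0 : ℝ)) = (0 : E → ℝ) from rfl, pdIter_zero_fun]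
    simp
  | insert a s ha ih =>
    have h1 : PDBddOn b S K n (fun t y ↦ F a t y + ∑ k ∈ s, F k t y) :=
      (hF a (Finset.mem_insert_self a s)).add hV hKV (hFs a (Finset.mem_insert_self a s))
        (fun t ht ↦ ContDiffOn.sum fun k hk ↦ hFs k (Finset.mem_insert_of_mem hk) t ht)
        (ih (fun k hk ↦ hFs k (Finset.mem_insert_of_mem hk)) fun k hk ↦ hF k (Finset.mem_insert_of_mem hk))
    simpa only [Finset.sum_insert ha] using h1

/-- Smoothness of slices is preserved by finite sums. [folklore] -/
theorem SmoothSlicesOn.sum {κ : Type*} (s : Finset κ) {F : κ → ℝ → E → ℝ}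
    (hFs : ∀ k ∈ s, SmoothSlicesOn V S (F k)) : SmoothSlicesOn V S (fun t y ↦ ∑ k ∈ s, F k t y) :=
  fun t ht ↦ ContDiffOn.sum fun k hk ↦ hFs k hk t ht

/-- **Products (anisotropic Leibniz bookkeeping)**: if all partial derivatives of order `≤ n` of
`Φ` and of `Ψ` are bounded, so are those of `Φ Ψ`. [folklore] -/
theorem PDBddOn.mul (hV : IsOpen V) (hKV : K ⊆ V) :
    ∀ {n : ℕ} {Φ Ψ : ℝ → E → ℝ}, SmoothSlicesOn V S Φ → SmoothSlicesOn V S Ψ →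
      PDBddOn b S K n Φ → PDBddOn b S K n Ψ → PDBddOn b S K n (fun t y ↦ Φ t y * Ψ t y) := by
  intro n
  induction n with
  | zero =>
    intro Φ Ψ _ _ hΦ hΨ
    rw [pdBddOn_zero_iff] at hΦ hΨ ⊢
    obtain ⟨C₁, hC₁⟩ := hΦ
    obtain ⟨C₂, hC₂⟩ := hΨ
    refine ⟨C₁ * C₂, fun t ht y hy ↦ ?_⟩
    rw [abs_mul]
    exact mul_le_mul (hC₁ t ht y hy) (hC₂ t ht y hy) (abs_nonneg _) ((abs_nonneg _).trans (hC₁ t ht y hy))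
  | succ n ih =>
    intro Φ Ψ hΦs hΨs hΦ hΨ L hL
    cases L with
    | nil =>
      obtain ⟨C₁, hC₁⟩ := hΦ.bound
      obtain ⟨C₂, hC₂⟩ := hΨ.bound
      refine ⟨C₁ * C₂, fun t ht y hy ↦ ?_⟩
      rw [pdIter_nil, abs_mul]
      exact mul_le_mul (hC₁ t ht y hy) (hC₂ t ht y hy) (abs_nonneg _) ((abs_nonneg _).trans (hC₁ t ht y hy))
    | cons i L =>
      have hL' : L.length ≤ n := by simpa using hL
      -- `∂_i (Φ Ψ) = ∂_iΦ Ψ + Φ ∂_iΨ` on `V`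
      have h1 : ∀ t ∈ S, EqOn (MetricCoord.pd b i (fun z ↦ Φ t z * Ψ t z))
          (fun z ↦ MetricCoord.pd b i (Φ t) z * Ψ t z + Φ t z * MetricCoord.pd b i (Ψ t) z) V :=
        fun t ht z hz ↦
          pd_mul (((hΦs t ht).contDiffAt (hV.mem_nhds hz)).differentiableAt (by simp))
            (((hΨs t ht).contDiffAt (hV.mem_nhds hz)).differentiableAt (by simp)) i
      have hA : PDBddOn b S K n (fun t z ↦ MetricCoord.pd b i (Φ t) z * Ψ t z) :=
        ih (hΦs.pd hV i) hΨs (hΦ.pd i) (hΨ.mono (Nat.le_succ n))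
      have hB : PDBddOn b S K n (fun t z ↦ Φ t z * MetricCoord.pd b i (Ψ t) z) :=
        ih hΦs (hΨs.pd hV i) (hΦ.mono (Nat.le_succ n)) (hΨ.pd i)
      obtain ⟨C, hC⟩ := (hA.add hV hKV ((hΦs.pd hV i).mul hΨs) (hΦs.mul (hΨs.pd hV i)) hB) L hL'
      refine ⟨C, fun t ht y hy ↦ ?_⟩
      rw [pdIter_cons, pdIter_congr hV L (h1 t ht) (hKV hy)]
      exact hC t ht y hy

/-- **Finite products of two bounded families over an index set** are covered by `mul` and `sum`;
here the frequently used form `Σ_k Φ_k Ψ_k`. [folklore] -/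
theorem PDBddOn.sum_mul (hV : IsOpen V) (hKV : K ⊆ V) {κ : Type*} (s : Finset κ)
    {F G : κ → ℝ → E → ℝ} (hFs : ∀ k ∈ s, SmoothSlicesOn V S (F k))
    (hGs : ∀ k ∈ s, SmoothSlicesOn V S (G k)) (hF : ∀ k ∈ s, PDBddOn b S K n (F k))
    (hG : ∀ k ∈ s, PDBddOn b S K n (G k)) :
    PDBddOn b S K n (fun t y ↦ ∑ k ∈ s, F k t y * G k t y) :=
  PDBddOn.sum hV hKV s (fun k hk ↦ (hFs k hk).mul (hGs k hk)) fun k hk ↦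
    PDBddOn.mul hV hKV (hFs k hk) (hGs k hk) (hF k hk) (hG k hk)

end Bdd

/-! ### Time derivatives of iterated partial derivatives -/

section Time

variable {b} {V K : Set E} {S : Set ℝ} {Φ : ℝ → E → ℝ} {t : ℝ} {y : E}

/-- Joint smoothness of `(y, t) ↦ Φ t y` on `V × S` passes to `∂_i Φ`. [folklore] -/
theorem contDiffOn_pd_family (hV : IsOpen V) (hS : UniqueDiffOn ℝ S)
    (hΦ : ContDiffOn ℝ ∞ (fun p : E × ℝ ↦ Φ p.2 p.1) (V ×ˢ S)) (i : ι) :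
    ContDiffOn ℝ ∞ (fun p : E × ℝ ↦ pd b i (Φ p.2) p.1) (V ×ˢ S) :=
  (contDiffOn_fderiv_slice (F := fun p : E × ℝ ↦ Φ p.2 p.1) hV hS hΦ).clm_apply contDiffOn_const

/-- Joint smoothness passes to `pdIter L Φ`. [folklore] -/
theorem contDiffOn_pdIter_family (hV : IsOpen V) (hS : UniqueDiffOn ℝ S) :
    ∀ (L : List ι) {Φ : ℝ → E → ℝ}, ContDiffOn ℝ ∞ (fun p : E × ℝ ↦ Φ p.2 p.1) (V ×ˢ S) →
      ContDiffOn ℝ ∞ (fun p : E × ℝ ↦ pdIter b L (Φ p.2) p.1) (V ×ˢ S)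
  | [], _, h => h
  | i :: L, Φ, h => contDiffOn_pdIter_family hV hS L (Φ := fun t ↦ pd b i (Φ t)) (contDiffOn_pd_family hV hS h i)

/-- Jointly smooth families have smooth slices. [folklore] -/
theorem smoothSlicesOn_of_contDiffOn (hΦ : ContDiffOn ℝ ∞ (fun p : E × ℝ ↦ Φ p.2 p.1) (V ×ˢ S)) :
    SmoothSlicesOn V S Φ := by
  intro t ht
  have hmap : ContDiffOn ℝ ∞ (fun y : E ↦ (y, t)) V := (contDiff_id.prodMk contDiff_const).contDiffOn
  exact hΦ.comp hmap fun y hy ↦ ⟨hy, ht⟩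

/-- **`∂_t ∂_i = ∂_i ∂_t`** for a jointly smooth family (symmetry of mixed partials within
`V × S`). [folklore] -/
theorem derivWithin_pd_comm (hV : IsOpen V) (hS : UniqueDiffOn ℝ S) (hS' : S ⊆ closure (interior S))
    (hΦ : ContDiffOn ℝ ∞ (fun p : E × ℝ ↦ Φ p.2 p.1) (V ×ˢ S)) (i : ι) (hy : y ∈ V) (ht : t ∈ S) :
    derivWithin (fun s ↦ pd b i (Φ s) y) S t = pd b i (fun z ↦ derivWithin (fun s ↦ Φ s z) S t) y := by
  have h := hasDerivWithinAt_fderiv_slice (F := fun p : E × ℝ ↦ Φ p.2 p.1) hV hS hΦ hy ht (hS' ht)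
  have h2 := ((ContinuousLinearMap.apply ℝ ℝ (b i)).hasFDerivAt.comp_hasDerivWithinAt t h).derivWithin
    (hS t ht)
  simpa [pd_apply, Function.comp_def] using h2

/-- **`∂_t ∂^L = ∂^L ∂_t`** for a jointly smooth family. [folklore] -/
theorem derivWithin_pdIter_comm (hV : IsOpen V) (hS : UniqueDiffOn ℝ S) (hS' : S ⊆ closure (interior S)) :
    ∀ (L : List ι) {Φ : ℝ → E → ℝ}, ContDiffOn ℝ ∞ (fun p : E × ℝ ↦ Φ p.2 p.1) (V ×ˢ S) →
      ∀ {y : E} {t : ℝ}, y ∈ V → t ∈ S →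
        derivWithin (fun s ↦ pdIter b L (Φ s) y) S t =
          pdIter b L (fun z ↦ derivWithin (fun s ↦ Φ s z) S t) y
  | [], _, _, _, _, _, _ => rfl
  | i :: L, Φ, hΦ, y, t, hy, ht => by
    simp only [pdIter_cons]
    rw [derivWithin_pdIter_comm hV hS hS' L (contDiffOn_pd_family hV hS hΦ i) hy ht]
    exact pdIter_congr hV L (fun z hz ↦ derivWithin_pd_comm hV hS hS' hΦ i hz ht) hy

/-- The time slices of `pdIter L Φ` are differentiable within `S`. [folklore] -/
theorem hasDerivWithinAt_pdIter (hV : IsOpen V) (hS : UniqueDiffOn ℝ S)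
    (hΦ : ContDiffOn ℝ ∞ (fun p : E × ℝ ↦ Φ p.2 p.1) (V ×ˢ S)) (L : List ι) (hy : y ∈ V) (ht : t ∈ S) :
    HasDerivWithinAt (fun s ↦ pdIter b L (Φ s) y)
      (derivWithin (fun s ↦ pdIter b L (Φ s) y) S t) S t := by
  have h := contDiffOn_pdIter_family (b := b) hV hS L hΦ
  exact (hasDerivWithinAt_tslice (F := fun p : E × ℝ ↦ pdIter b L (Φ p.2) p.1)
    (h.differentiableOn (by simp)) hy ht).differentiableWithinAt.hasDerivWithinAt

/-- **Time integration**: on `[t₁, T) × K`, a bound `C` for `∂_t ∂^L Φ` and a bound `C₀` for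
`∂^L Φ(t₁)` on `K` give `|∂^L Φ| ≤ C₀ + C (T − t₁)` (mean value inequality on `[t₁, t]`;
Topping 2006, p. 48: "by integrating with respect to time"). [cite: Topping2006, §5.3, p. 48] -/
theorem abs_pdIter_le_of_deriv {t₁ T : ℝ} (hV : IsOpen V) (hKV : K ⊆ V)
    (hΦ : ContDiffOn ℝ ∞ (fun p : E × ℝ ↦ Φ p.2 p.1) (V ×ˢ Ico t₁ T)) (L : List ι) {C₀ C : ℝ}
    (h0 : ∀ y ∈ K, |pdIter b L (Φ t₁) y| ≤ C₀)
    (hd : ∀ s ∈ Ico t₁ T, ∀ y ∈ K, |derivWithin (fun s' ↦ pdIter b L (Φ s') y) (Ico t₁ T) s| ≤ C) :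
    ∀ t ∈ Ico t₁ T, ∀ y ∈ K, |pdIter b L (Φ t) y| ≤ C₀ + C * (T - t₁) := by
  intro t ht y hy
  have hS : UniqueDiffOn ℝ (Ico t₁ T) := uniqueDiffOn_Ico t₁ T
  have hsub : Icc t₁ t ⊆ Ico t₁ T := fun s hs ↦ ⟨hs.1, hs.2.trans_lt ht.2⟩
  set f : ℝ → ℝ := fun s ↦ pdIter b L (Φ s) y with hf
  have hder : ∀ s ∈ Icc t₁ t, HasDerivWithinAt f (derivWithin f (Ico t₁ T) s) (Icc t₁ t) s :=
    fun s hs ↦ (hasDerivWithinAt_pdIter hV hS hΦ L (hKV hy) (hsub hs)).mono hsub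
  have hbound : ∀ s ∈ Ico t₁ t, ‖derivWithin f (Ico t₁ T) s‖ ≤ C := fun s hs ↦ by
    rw [Real.norm_eq_abs]; exact hd s ⟨hs.1, hs.2.trans ht.2⟩ y hy
  have hmv := norm_image_sub_le_of_norm_deriv_le_segment' hder hbound t ⟨ht.1, le_rfl⟩
  rw [Real.norm_eq_abs] at hmv
  have hC : 0 ≤ C := by
    rcases eq_or_lt_of_le ht.1 with h | h
    · exact le_trans (abs_nonneg _) (hd t₁ ⟨le_rfl, by rw [h]; exact ht.2⟩ y hy)
    · exact le_trans (norm_nonneg _) (hbound t₁ ⟨le_rfl, h⟩)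
  calc |pdIter b L (Φ t) y| = |f t| := rfl
    _ ≤ |f t₁| + |f t - f t₁| := by
        have := abs_add_le (f t₁) (f t - f t₁); rwa [add_sub_cancel] at this
    _ ≤ C₀ + C * (t - t₁) := add_le_add (h0 y hy) hmv
    _ ≤ C₀ + C * (T - t₁) := by nlinarith [ht.2.le]

end Time

end MetricCoord

end Literature.Geometry.Lorentzian

end
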